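import Literature.Computability.AlgebraicComplexity.LMR13ResidualClauses
import Literature.Computability.AlgebraicComplexity.LMR13DualSchemeDetProofs
import Literature.Computability.AlgebraicComplexity.MR04HessianExactRank
import HarnessLib

/-!
# Landsberg–Manivel–Ressayre 2013, Prop. 3.5.1: `Δ(P_Λ)` misses the orbit `GL(W)·det_n`
# (the Hessian of `P_Λ` vanishes identically) — PROVED

Cell `val-lit` (D-0074), row `LMR13-A`, typer/prover `val-lit-t11` (g2). Theorem-only companion of
`LMR13DualVarieties.lean` (no definitions, no named facts): of conjunct (b) of the typed
`LMR2013_prop_3_5_1` — "`\overline{GL(W)·P_Λ}` is an irreducible codimension one component of the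
boundary of `\overline{GL(W)·[det_n]}`" (journal p. 481, `paper:galaxy-pdf-8572435590081880720
p0013.txt:L1`; arXiv `paper:arxiv-1004.4802 p0008.txt:L60–63`) — this file PROVES the inclusion in
the boundary, `orbitClosure (pLambda n) ⊆ orbitClosure det_n ∖ GL(W)·det_n`
(`orbitClosure_pLambda_subset_boundary`, `n` odd, `n ≥ 3`), i.e. that NO point of the orbit of `det_n`
is a degeneration of `P_Λ` (`disjoint_orbitClosure_pLambda_glOrbit_detPoly`,
`detPoly_not_mem_orbitClosure_pLambda`). With the companions already in the tree
(`LMR13BoundaryOrbitProofs.lean`, `LMR13BoundaryFormNotCone.lean`, `LMR13ResidualClauses.lean`) the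
named fact is thereby EQUIVALENT to its two dimension-theoretic clauses — maximality of `Δ(P_Λ)`
among the irreducible subsets of the boundary, and codimension one
(`LMR2013_prop_3_5_1_iff_maximal_codim`); those stay FACT.

## The argument (ours — DEVIATION from print, disclosed)

LMR obtain "not contained in the orbit of the determinant" from the stabiliser count / the non-cone
property and the local closedness of orbits (p. 481; arXiv `p0008.txt:L93–97`). The tree has no
orbit–stabiliser or constructibility theory, so `Δ(P_Λ)` is separated from `GL(W)·det_n` by a CLOSED
`GL(W)`-INVARIANT CONDITION instead: **the Hessian of `P_Λ` is singular at every point**, whereas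
the Hessian of `det_n` at the identity matrix is nonsingular.

* `P_Λ(A + S) = (1/n)·tr(adj(A)·S)` is LINEAR in the symmetric part `S` (`aeval_pLambda_skew_add_sym`,
  from `aeval_pLambda` of `LMR13BoundaryFormNotCone.lean`). Hence along any two SYMMETRIC directions
  `E, E'` the restriction `(a,b) ↦ P_Λ(y + aE + bE')` is affine-linear
  (`totalDegree_aeval_pLambda_sym_family_le`), so by the affine chain rule
  (`hessianMatrix_aeval_C_add_linear`, `HessianRank.lean`) `Eᵀ · Hess(P_Λ)(y) · E' = 0`
  (`dotProduct_hessianMatrix_pLambda_mulVec`): the symmetric matrices form a totally isotropic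
  subspace of `Hess(P_Λ)(y)` at EVERY point `y`.
* Linear algebra (`det_hessianMatrix_pLambda_eq_zero`): `Hess(P_Λ)(y)` then maps `Sym_n` into its
  dot-orthogonal `Skew_n`, and `dim Skew_n < dim Sym_n` (an explicit injection `Skew_n ↪ Sym_n`
  folding a skew vector into the strict upper triangle misses `E_{00}`), so the map has a kernel and
  `det Hess(P_Λ)(y) = 0`. (So `P_Λ` is a form with identically vanishing Hessian which is NOT a cone
  — `pLambda_not_cone`, `LMR13BoundaryFormNotCone.lean` — a Gordan–Noether-type example.)
* `Q ↦ det Hess(Q)(x₀)` is a polynomial in the coefficients of the degree-`n` form `Q` (the generic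
  form `genericFormDeg`, pattern of `lmrDualScheme_isCoeffZariskiClosed`); it vanishes on `GL(W)·P_Λ`
  by congruence (`det_hessianMatrix_eq_zero_of_mem_glOrbit_pLambda`), hence on `Δ(P_Λ)`
  (`det_hessianMatrix_eq_zero_of_mem_orbitClosure_pLambda`, via `mem_orbitClosure_iff`).
* `Hess(det_n)(Id)` is nonsingular for `n ≥ 2` (`isUnit_hessianMatrix_detPoly_one`): its entries are
  `H_{(c,d),(a,b)} = [d ≠ b]([a = b][c = d] − [a = d][b = c])` (`hessianMatrix_detPoly_one_apply`, from
  `eval_pderiv_pderiv_detPoly` of `MR04HessianExactRank.lean` — the signed `(n−2)`-minors at `Id`), so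
  `H v = 0` forces `v_{dc} = 0` off the diagonal and `∑_{b ≠ c} v_{bb} = 0` for every `c`, whence
  `(n − 1)·∑_b v_{bb} = 0` and `v = 0`.
* Finally `det_n ∈ Δ(P_Λ)` would give `det Hess(det_n)(Id) = 0`; and `g·det_n ∈ Δ(P_Λ)` would give
  `det_n ∈ Δ(P_Λ)` by `GL(W)`-stability of orbit closures (`orbitClosure_subset_of_mem_holds`).

Honest framing: an elementary companion to a 2013 paper (classical invariant theory of the Hessian);
**VP ≠ VNP is NOT proved and nothing here is progress on it.**

## References

* [LandsbergManivelRessayre2013] J. M. Landsberg, L. Manivel, N. Ressayre, *Hypersurfaces with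
  degenerate duals and the Geometric Complexity Theory Program*, Comment. Math. Helv. 88 (2013)
  469–484, Prop. 3.5.1 (p. 481); arXiv:1004.4802 (§3.5).
* [MignonRessayre2004] T. Mignon, N. Ressayre, *A quadratic bound for the determinant and permanent
  problem*, Int. Math. Res. Not. 2004:79, 4241–4253, §3 (the Hessian of `det_n`; second partial
  derivatives = signed minors).
* [Landsberg2017] J. M. Landsberg, *Geometry and Complexity Theory*, CUP 2017, §6.4.5 (the Hessian
  `P_{d−2,2}`), §6.7.2 (`P_Λ`).
-/

open MvPolynomial Matrix

namespace Literature.Computability.AlgebraicComplexity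

section SymIsotropic

variable {n : ℕ}

/-- **`P_Λ(A + S) = (1/n)·tr(adj(A)·S)`** for a skew `A` and a symmetric `S` with entries in any
commutative `ℂ`-algebra (LMR 2013 §3.5, "`P_Λ(M) = det_n(A,…,A,S)`", arXiv `p0008.txt:L49–52`;
the `ℂ`-valued case is `eval_pLambda_skew_add_sym`). [cite: LandsbergManivelRessayre2013, §3.5 (p. 480)] -/
theorem aeval_pLambda_skew_add_sym {R : Type*} [CommRing R] [Algebra ℂ R]
    {A S : Matrix (Fin n) (Fin n) R} (hA : Aᵀ = -A) (hS : Sᵀ = S) :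
    aeval (fun p : Fin n × Fin n => (A + S) p.1 p.2) (pLambda n) =
      (1 / (n : ℂ)) • (A.adjugate * S).trace := by
  rw [aeval_pLambda]
  have h1 : (1 / 2 : ℂ) • (A + S - (A + S)ᵀ) = A := by
    rw [Matrix.transpose_add, hA, hS, show A + S - (-A + S) = A + A by abel, ← two_smul ℂ A,
      smul_smul]
    norm_num
  have h2 : (1 / 2 : ℂ) • (A + S + (A + S)ᵀ) = S := by
    rw [Matrix.transpose_add, hA, hS, show A + S + (-A + S) = S + S by abel, ← two_smul ℂ S,
      smul_smul]
    norm_num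
  rw [h1, h2]

/-- Along a two-parameter family `y + aE + bE'` with SYMMETRIC directions `E, E'` the form `P_Λ` is
affine-linear in `(a, b)` (it is linear in the symmetric part of its argument; LMR 2013 §3.5).
[cite: LandsbergManivelRessayre2013, §3.5 (p. 480)] -/
theorem totalDegree_aeval_pLambda_sym_family_le (y : Fin n × Fin n → ℂ)
    {E E' : Fin n × Fin n → ℂ} (hE : ∀ p, E p.swap = E p) (hE' : ∀ p, E' p.swap = E' p) :
    (aeval (fun t : Fin n × Fin n =>
        C (y t) + ∑ v : Fin 2, C ((Matrix.of fun p v => ![E p, E' p] v) t v) * X v)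
      (pLambda n)).totalDegree ≤ 1 := by
  classical
  set T := MvPolynomial (Fin 2) ℂ
  set Y : Matrix (Fin n) (Fin n) ℂ := Matrix.of fun i j => y (i, j) with hY
  set A₀ : Matrix (Fin n) (Fin n) ℂ := (1 / 2 : ℂ) • (Y - Yᵀ) with hA₀
  set S₀ : Matrix (Fin n) (Fin n) ℂ := (1 / 2 : ℂ) • (Y + Yᵀ) with hS₀
  set Eh : Matrix (Fin n) (Fin n) ℂ := Matrix.of fun i j => E (i, j) with hEh
  set Eh' : Matrix (Fin n) (Fin n) ℂ := Matrix.of fun i j => E' (i, j) with hEh'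
  set A : Matrix (Fin n) (Fin n) T := A₀.map C with hA
  set S : Matrix (Fin n) (Fin n) T :=
    S₀.map C + (X 0 : T) • Eh.map C + (X 1 : T) • Eh'.map C with hS
  have hAt : Aᵀ = -A := by
    rw [hA, ← Matrix.transpose_map, ← Matrix.map_neg _ (fun a => map_neg C a)]
    · congr 1
      rw [hA₀, Matrix.transpose_smul, Matrix.transpose_sub, Matrix.transpose_transpose, ← smul_neg,
        neg_sub]
  have hEht : Ehᵀ = Eh := Matrix.ext fun i j => by
    simp only [hEh, Matrix.transpose_apply, Matrix.of_apply]; exact hE (i, j)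
  have hEht' : Eh'ᵀ = Eh' := Matrix.ext fun i j => by
    simp only [hEh', Matrix.transpose_apply, Matrix.of_apply]; exact hE' (i, j)
  have hSt : Sᵀ = S := by
    rw [hS, Matrix.transpose_add, Matrix.transpose_add, Matrix.transpose_smul, Matrix.transpose_smul,
      ← Matrix.transpose_map, ← Matrix.transpose_map, ← Matrix.transpose_map, hEht, hEht']
    congr 2
    rw [hS₀, Matrix.transpose_smul, Matrix.transpose_add, Matrix.transpose_transpose, add_comm Yᵀ Y]
  -- the family is `A + S`
  have hfam : (fun t : Fin n × Fin n =>
      C (y t) + ∑ v : Fin 2, C ((Matrix.of fun p v => ![E p, E' p] v) t v) * X v) =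
      fun p => (A + S) p.1 p.2 := by
    funext t
    obtain ⟨i, j⟩ := t
    simp only [hA, hS, hA₀, hS₀, hEh, hEh', hY, Matrix.add_apply, Matrix.map_apply, Matrix.smul_apply,
      Matrix.sub_apply, Matrix.transpose_apply, Matrix.of_apply, Fin.sum_univ_two,
      Matrix.cons_val_zero, Matrix.cons_val_one, smul_eq_mul, map_mul, map_sub,
      map_add]
    have h2 : (2 : T) * C (1 / 2 : ℂ) = 1 := by
      rw [← map_ofNat C 2, ← map_mul]
      norm_num
    linear_combination (-(C (y (i, j)) : T)) * h2
  rw [hfam, aeval_pLambda_skew_add_sym hAt hSt]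
  -- expand: everything is `C (…) + X 0 * C (…) + X 1 * C (…)`
  have hadj : A.adjugate = A₀.adjugate.map C := by
    rw [hA, ← RingHom.mapMatrix_apply, ← RingHom.map_adjugate, RingHom.mapMatrix_apply]
  have htr : (A.adjugate * S).trace =
      C (A₀.adjugate * S₀).trace + X 0 * C (A₀.adjugate * Eh).trace +
        X 1 * C (A₀.adjugate * Eh').trace := by
    rw [hadj, hS, Matrix.mul_add, Matrix.mul_add, Matrix.mul_smul, Matrix.mul_smul,
      ← Matrix.map_mul, ← Matrix.map_mul, ← Matrix.map_mul, Matrix.trace_add, Matrix.trace_add,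
      Matrix.trace_smul, Matrix.trace_smul, smul_eq_mul, smul_eq_mul,
      AddMonoidHom.map_trace C, AddMonoidHom.map_trace C, AddMonoidHom.map_trace C]
  rw [htr]
  refine (totalDegree_smul_le _ _).trans ?_
  refine (totalDegree_add _ _).trans (max_le ((totalDegree_add _ _).trans (max_le ?_ ?_)) ?_)
  · rw [totalDegree_C]; exact Nat.zero_le _
  · refine (totalDegree_mul _ _).trans ?_
    rw [totalDegree_X, totalDegree_C]
  · refine (totalDegree_mul _ _).trans ?_
    rw [totalDegree_X, totalDegree_C]

/-- **The symmetric matrices are a totally isotropic subspace of `Hess(P_Λ)(y)` at every point `y`:**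
`Eᵀ · Hess(P_Λ)(y) · E' = 0` for symmetric `E, E'` (affine chain rule `hessianMatrix_aeval_C_add_linear`
applied to the affine-linear family of `totalDegree_aeval_pLambda_sym_family_le`).
[cite: LandsbergManivelRessayre2013, §3.5 (p. 480)] -/
theorem dotProduct_hessianMatrix_pLambda_mulVec (y : Fin n × Fin n → ℂ)
    {E E' : Fin n × Fin n → ℂ} (hE : ∀ p, E p.swap = E p) (hE' : ∀ p, E' p.swap = E' p) :
    E ⬝ᵥ (hessianMatrix (pLambda n) y *ᵥ E') = 0 := by
  classical
  set L : Matrix (Fin n × Fin n) (Fin 2) ℂ := Matrix.of fun p v => ![E p, E' p] v with hL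
  have hdeg := totalDegree_aeval_pLambda_sym_family_le y hE hE'
  have hchain := hessianMatrix_aeval_C_add_linear y L (pLambda n) (0 : Fin 2 → ℂ)
  have hzero : hessianMatrix (aeval (fun t : Fin n × Fin n =>
      C (y t) + ∑ v : Fin 2, C (L t v) * X v) (pLambda n)) (0 : Fin 2 → ℂ) = 0 := by
    ext u v
    rw [hessianMatrix_apply, pderiv_pderiv_eq_zero_of_totalDegree_le_one hdeg, map_zero,
      Matrix.zero_apply]
  have hpt : (fun t => y t + ∑ v : Fin 2, L t v * (0 : Fin 2 → ℂ) v) = y := by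
    funext t; simp
  rw [hzero, hpt] at hchain
  have h01 := congr_fun (congr_fun hchain 0) 1
  simp only [Matrix.zero_apply, Matrix.mul_apply, Matrix.transpose_apply, hL, Matrix.of_apply,
    Matrix.cons_val_zero, Matrix.cons_val_one] at h01
  rw [dotProduct]
  simp only [Matrix.mulVec, dotProduct, Finset.mul_sum]
  rw [Finset.sum_comm]
  rw [h01]
  refine Finset.sum_congr rfl fun j _ => ?_
  rw [Finset.sum_mul]
  refine Finset.sum_congr rfl fun i _ => ?_
  ring

end SymIsotropic

section Singular

variable {n : ℕ}

/-- **`P_Λ` has identically vanishing Hessian:** `det Hess(P_Λ)(y) = 0` at every point `y` (`n ≥ 1`).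
Linear algebra on `dotProduct_hessianMatrix_pLambda_mulVec`: `Hess(P_Λ)(y)` maps the symmetric
vectors into the skew ones and `dim Skew_n < dim Sym_n`, so it has a kernel. (Proof ours; the printed
mechanism for Prop. 3.5.1 (b) is the stabiliser count, p. 481.)
[cite: LandsbergManivelRessayre2013, Proposition 3.5.1 (p. 481)] -/
theorem det_hessianMatrix_pLambda_eq_zero (hn : 1 ≤ n) (y : Fin n × Fin n → ℂ) :
    (hessianMatrix (pLambda n) y).det = 0 := by
  classical
  set H := hessianMatrix (pLambda n) y with hH
  have e1 : ∀ p q : Fin n × Fin n, q.swap = p ↔ q = p.swap := fun p q =>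
    ⟨fun h => by rw [← h, Prod.swap_swap], fun h => by rw [h, Prod.swap_swap]⟩
  -- symmetric and skew vectors, as kernels
  set T : (Fin n × Fin n → ℂ) →ₗ[ℂ] (Fin n × Fin n → ℂ) :=
    LinearMap.funLeft ℂ ℂ (Prod.swap : Fin n × Fin n → Fin n × Fin n) with hT
  have hTv : ∀ (v : Fin n × Fin n → ℂ) (p : Fin n × Fin n), T v p = v p.swap := fun v p => rfl
  set Sy : Submodule ℂ (Fin n × Fin n → ℂ) := LinearMap.ker (T - LinearMap.id) with hSy
  set Sk : Submodule ℂ (Fin n × Fin n → ℂ) := LinearMap.ker (T + LinearMap.id) with hSk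
  have memSy : ∀ v, v ∈ Sy ↔ ∀ p, v p.swap = v p := by
    intro v
    rw [hSy, LinearMap.mem_ker, LinearMap.sub_apply, LinearMap.id_apply, sub_eq_zero,
      _root_.funext_iff]
    simp only [hTv]
  have memSk : ∀ v, v ∈ Sk ↔ ∀ p, v p.swap = -v p := by
    intro v
    rw [hSk, LinearMap.mem_ker, LinearMap.add_apply, LinearMap.id_apply, add_eq_zero_iff_eq_neg,
      _root_.funext_iff]
    simp only [hTv, Pi.neg_apply]
  -- `H` maps symmetric vectors to skew vectors (isotropy of `Sym`)
  have hmap : ∀ v ∈ Sy, H *ᵥ v ∈ Sk := by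
    intro v hv
    rw [memSk]
    intro p
    set w : Fin n × Fin n → ℂ := Pi.single p 1 + Pi.single p.swap 1 with hw
    have hws : ∀ q : Fin n × Fin n, w q.swap = w q := by
      intro q
      simp only [hw, Pi.add_apply, Pi.single_apply, e1]
      exact add_comm _ _
    have h0 := dotProduct_hessianMatrix_pLambda_mulVec y hws ((memSy v).mp hv)
    rw [hw, add_dotProduct, single_dotProduct, single_dotProduct, one_mul, one_mul] at h0
    exact eq_neg_of_add_eq_zero_right h0
  set Lr : Sy →ₗ[ℂ] Sk := (H.mulVecLin.domRestrict Sy).codRestrict Sk fun v => hmap v.1 v.2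
    with hLr
  -- `dim Skew < dim Sym`: fold a skew vector into the strict upper triangle
  set ψ₀ : (Fin n × Fin n → ℂ) →ₗ[ℂ] (Fin n × Fin n → ℂ) :=
    { toFun := fun u p => if p.1 < p.2 then u p else if p.2 < p.1 then u p.swap else 0
      map_add' := fun u u' => by
        funext p
        simp only [Pi.add_apply]
        split_ifs <;> simp
      map_smul' := fun c u => by
        funext p
        simp only [Pi.smul_apply, smul_eq_mul, RingHom.id_apply]
        split_ifs <;> simp } with hψ₀
  have hψ₀v : ∀ u p, ψ₀ u p = if p.1 < p.2 then u p else if p.2 < p.1 then u p.swap else 0 :=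
    fun u p => rfl
  have hψS : ∀ u ∈ Sk, ψ₀ u ∈ Sy := by
    intro u _
    rw [memSy]
    rintro ⟨i, j⟩
    simp only [hψ₀v, Prod.swap_prod_mk]
    rcases lt_trichotomy i j with hij | rfl | hji
    · rw [if_neg (lt_asymm hij), if_pos hij, if_pos hij]
    · rw [if_neg (lt_irrefl i), if_neg (lt_irrefl i)]
    · rw [if_pos hji, if_neg (lt_asymm hji), if_pos hji]
  set ψ : Sk →ₗ[ℂ] Sy := (ψ₀.domRestrict Sk).codRestrict Sy fun u => hψS u.1 u.2 with hψ
  have hψv : ∀ (u : Sk) (p : Fin n × Fin n), (ψ u : Fin n × Fin n → ℂ) p =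
      if p.1 < p.2 then (u : Fin n × Fin n → ℂ) p
        else if p.2 < p.1 then (u : Fin n × Fin n → ℂ) p.swap else 0 := fun u p => rfl
  have hinj : Function.Injective ψ := by
    rw [← LinearMap.ker_eq_bot, LinearMap.ker_eq_bot']
    intro u hu
    have hu' : ∀ p, (ψ u : Fin n × Fin n → ℂ) p = 0 := fun p => by rw [hu]; rfl
    have hsk := (memSk u).mp u.2
    apply Subtype.ext
    funext p
    obtain ⟨i, j⟩ := p
    change (u : Fin n × Fin n → ℂ) (i, j) = 0
    rcases lt_trichotomy i j with hij | rfl | hji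
    · have := hu' (i, j)
      simp only [hψv, hij, if_true] at this
      exact this
    · have h3 := hsk (i, i)
      rw [Prod.swap_prod_mk] at h3
      exact self_eq_neg.mp h3
    · have := hu' (j, i)
      simp only [hψv, hji, if_true] at this
      have h3 := hsk (i, j)
      rw [Prod.swap_prod_mk, this] at h3
      exact neg_eq_zero.mp h3.symm
  have hne : LinearMap.range ψ ≠ ⊤ := by
    intro htop
    set z : Fin n := ⟨0, hn⟩ with hz
    have e3 : ∀ q : Fin n × Fin n, q.swap = (z, z) ↔ q = (z, z) := fun q =>
      ⟨fun h => by rw [← Prod.swap_swap q, h, Prod.swap_prod_mk],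
        fun h => by rw [h, Prod.swap_prod_mk]⟩
    have hzS : (Pi.single (z, z) (1 : ℂ) : Fin n × Fin n → ℂ) ∈ Sy := by
      rw [memSy]
      intro q
      simp only [Pi.single_apply, e3]
    have hmem : (⟨Pi.single (z, z) (1 : ℂ), hzS⟩ : Sy) ∈ LinearMap.range ψ :=
      htop ▸ Submodule.mem_top
    obtain ⟨u, hu⟩ := hmem
    have := congr_arg (fun w : Sy => (w : Fin n × Fin n → ℂ) (z, z)) hu
    simp only [hψv, lt_self_iff_false, if_false, Pi.single_eq_same] at this
    exact zero_ne_one this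
  have hdim : Module.finrank ℂ Sk < Module.finrank ℂ Sy := by
    rw [← LinearMap.finrank_range_of_inj hinj]
    exact Submodule.finrank_lt hne
  -- hence `Lr` has a kernel vector: a nonzero `v` with `H v = 0`
  have hker : LinearMap.ker Lr ≠ ⊥ := LinearMap.ker_ne_bot_of_finrank_lt hdim
  obtain ⟨v, hvker, hv0⟩ := Submodule.exists_mem_ne_zero_of_ne_bot hker
  have hHv : H *ᵥ (v : Fin n × Fin n → ℂ) = 0 := by
    have := congr_arg Subtype.val (LinearMap.mem_ker.mp hvker)
    exact this
  have hv0' : (v : Fin n × Fin n → ℂ) ≠ 0 := fun h => hv0 (Subtype.ext h)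
  have hnot : ¬ Function.Injective H.mulVec := fun hinjH =>
    hv0' (hinjH (by rw [hHv, Matrix.mulVec_zero]))
  rwa [Matrix.mulVec_injective_iff_isUnit, Matrix.isUnit_iff_isUnit_det, isUnit_iff_ne_zero,
    not_not] at hnot

end Singular

section OrbitClosure

variable {n : ℕ}

/-- Evaluation commutes with ring maps: `φ(q(x)) = (φ q)(φ ∘ x)`. [folklore] -/
private theorem ringHom_eval {R S τ : Type*} [CommRing R] [CommRing S] (φ : R →+* S) (x : τ → R)
    (q : MvPolynomial τ R) : φ (eval x q) = eval (φ ∘ x) (map φ q) := by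
  rw [eval_map, show eval x q = eval₂ (RingHom.id R) x q from rfl, eval₂_comp_left, RingHom.comp_id]

/-- On the orbit `GL(W)·P_Λ` every Hessian is singular at every point: `Hess(P_Λ ∘ g)(x) =
gᵀ·Hess(P_Λ)(gx)·g` (`hessianMatrix_aeval_of_affine`). [cite: LandsbergManivelRessayre2013, Proposition 3.5.1 (p. 481)] -/
theorem det_hessianMatrix_eq_zero_of_mem_glOrbit_pLambda (hn : 1 ≤ n)
    {Q : MvPolynomial (Fin n × Fin n) ℂ} (hQ : Q ∈ glOrbit (Fin n × Fin n) ℂ (pLambda n))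
    (x : Fin n × Fin n → ℂ) : (hessianMatrix Q x).det = 0 := by
  obtain ⟨g, rfl⟩ := hQ
  beta_reduce
  rw [linSubstRep_apply, linSubst,
    hessianMatrix_aeval_of_affine _ (fun i u v => pderiv_pderiv_linSubst_X_eq_zero _ i u v),
    Matrix.det_mul, Matrix.det_mul, det_hessianMatrix_pLambda_eq_zero hn, mul_zero, zero_mul]

/-- **`det Hess(Q)(x₀) = 0` for every degeneration `Q ∈ Δ(P_Λ)`** (`n` odd) and every point `x₀`:
`Q ↦ det Hess(Q)(x₀)` is a polynomial function of the coefficients of the degree-`n` form `Q` (generic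
form `genericFormDeg`), vanishing on `GL(W)·P_Λ`, hence on its Zariski closure (`mem_orbitClosure_iff`).
[cite: LandsbergManivelRessayre2013, Proposition 3.5.1 (p. 481)] -/
theorem det_hessianMatrix_eq_zero_of_mem_orbitClosure_pLambda (hn : Odd n)
    {Q : MvPolynomial (Fin n × Fin n) ℂ} (hQ : Q ∈ orbitClosure (pLambda n))
    (x₀ : Fin n × Fin n → ℂ) : (hessianMatrix Q x₀).det = 0 := by
  classical
  have hn1 : 1 ≤ n := by obtain ⟨k, rfl⟩ := hn; omega
  have hP : (pLambda n).IsHomogeneous n := pLambda_isHomogeneous hn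
  have hQhom : Q.IsHomogeneous n := hP.of_mem_orbitClosure hQ
  -- the generic form of degree `n` over the coordinate ring of coefficient space
  obtain ⟨G, hG⟩ : ∃ G : MvPolynomial (Fin n × Fin n) (MvPolynomial ((Fin n × Fin n) →₀ ℕ) ℂ),
      ∀ h : MvPolynomial (Fin n × Fin n) ℂ, h.IsHomogeneous n → map (eval (coeffVec h)) G = h := by
    refine ⟨map (rename (Subtype.val : DegIdx (Fin n × Fin n) n → ((Fin n × Fin n) →₀ ℕ))).toRingHom
      (genericFormDeg (Fin n × Fin n) ℂ n), fun h hh => ?_⟩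
    rw [MvPolynomial.map_map]
    have hcomp : (eval (coeffVec h)).comp
        (rename (Subtype.val : DegIdx (Fin n × Fin n) n → ((Fin n × Fin n) →₀ ℕ))).toRingHom =
        eval (formCoeff n h) := by
      refine RingHom.ext fun q => ?_
      rw [RingHom.coe_comp, Function.comp_apply, AlgHom.toRingHom_eq_coe, AlgHom.coe_toRingHom,
        eval_rename]
      rfl
    rw [hcomp, map_eval_formCoeff_genericFormDeg hh]
  -- `det Hess(·)(x₀)` as a polynomial in the coefficients
  obtain ⟨p, hp⟩ : ∃ p : MvPolynomial ((Fin n × Fin n) →₀ ℕ) ℂ,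
      ∀ h : MvPolynomial (Fin n × Fin n) ℂ, h.IsHomogeneous n →
        aeval (coeffVec h) p = (hessianMatrix h x₀).det := by
    refine ⟨(hessianMatrix G (fun i => C (x₀ i))).det, fun h hh => ?_⟩
    rw [show aeval (coeffVec h) (hessianMatrix G fun i => C (x₀ i)).det =
        eval (coeffVec h) (hessianMatrix G fun i => C (x₀ i)).det from rfl,
      RingHom.map_det, RingHom.mapMatrix_apply]
    congr 1
    ext u v
    rw [Matrix.map_apply, hessianMatrix_apply, hessianMatrix_apply, ringHom_eval, ← pderiv_map,
      ← pderiv_map, hG h hh]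
    congr 2
    funext i
    simp only [Function.comp_apply, eval_C]
  have h0 := (mem_orbitClosure_iff.mp hQ) p fun h hh => by
    have hhom : h.IsHomogeneous n := by
      obtain ⟨g, rfl⟩ := hh
      beta_reduce
      rw [linSubstRep_apply]
      exact linSubst_isHomogeneous _ hP
    rw [hp h hhom]
    exact det_hessianMatrix_eq_zero_of_mem_glOrbit_pLambda hn1 hh x₀
  rwa [hp Q hQhom] at h0

end OrbitClosure

section DetHessian

variable {n : ℕ}

/-- A permutation fixing every point outside `{b, d}` is `1` or `swap b d`. [folklore] -/
private theorem perm_eq_one_or_swap {b d : Fin n} (π : Equiv.Perm (Fin n))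
    (hfix : ∀ i ∈ (Finset.univ.erase b).erase d, π i = i) : π = 1 ∨ π = Equiv.swap b d := by
  have key : ∀ i, i ≠ b → i ≠ d → π i = i := fun i hb hd =>
    hfix i (Finset.mem_erase.mpr ⟨hd, Finset.mem_erase.mpr ⟨hb, Finset.mem_univ _⟩⟩)
  -- images of `b` and `d` lie in `{b, d}`
  have himg : ∀ j, j = b ∨ j = d → π j = b ∨ π j = d := by
    intro j hj
    by_contra hcon
    rw [not_or] at hcon
    have hfixj : π (π j) = π j := key _ hcon.1 hcon.2
    have : π j = j := π.injective hfixj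
    rcases hj with rfl | rfl
    · exact hcon.1 this
    · exact hcon.2 this
  by_cases hb : π b = b
  · left
    refine Equiv.ext fun i => ?_
    by_cases hib : i = b
    · subst hib; simp [hb]
    by_cases hid : i = d
    · subst hid
      rcases himg i (Or.inr rfl) with h | h
      · exact absurd (π.injective (h.trans hb.symm)) hib
      · simpa using h
    · simpa using key i hib hid
  · right
    have hπb : π b = d := by
      rcases himg b (Or.inl rfl) with h | h
      · exact absurd h hb
      · exact h
    have hbd : b ≠ d := fun h => hb (hπb.trans h.symm)
    have hπd : π d = b := by
      rcases himg d (Or.inr rfl) with h | h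
      · exact h
      · exact absurd (π.injective (h.trans hπb.symm)) hbd.symm
    refine Equiv.ext fun i => ?_
    by_cases hib : i = b
    · subst hib; rw [hπb, Equiv.swap_apply_left]
    by_cases hid : i = d
    · subst hid; rw [hπd, Equiv.swap_apply_right]
    · rw [key i hib hid, Equiv.swap_apply_of_ne_of_ne hib hid]

/-- **The Hessian of `det_n` at the identity matrix:** `∂_{cd}∂_{ab} det_n (Id) = [d ≠ b]([a = b][c = d] −
[a = d][b = c])` — the signed `(n−2)`-minors of `Id` (from `eval_pderiv_pderiv_detPoly`,
`MR04HessianExactRank.lean`: only `π = 1` and `π = swap b d` survive). It is the bilinear form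
`(X, Y) ↦ tr X·tr Y − tr(XY)`. [cite: MignonRessayre2004, §3.2.1 and Prop. 3.2 (preprint pp. 7, 10)] -/
theorem hessianMatrix_detPoly_one_apply (a b c d : Fin n) :
    hessianMatrix (detPoly (Fin n) ℂ) (fun p => (1 : Matrix (Fin n) (Fin n) ℂ) p.1 p.2) (c, d) (a, b) =
      if d = b then 0 else
        (if b = a ∧ d = c then 1 else 0) - (if d = a ∧ b = c then 1 else 0) := by
  classical
  rw [hessianMatrix_apply, eval_pderiv_pderiv_detPoly]
  simp only [Matrix.one_apply, Finset.prod_boole]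
  by_cases hdb : d = b
  · simp [hdb]
  rw [if_neg hdb]
  have h1s : (1 : Equiv.Perm (Fin n)) ≠ Equiv.swap b d := by
    intro h
    have := Equiv.congr_fun h b
    rw [Equiv.Perm.one_apply, Equiv.swap_apply_left] at this
    exact hdb this.symm
  rw [Finset.sum_eq_add_of_mem (1 : Equiv.Perm (Fin n)) (Equiv.swap b d) (Finset.mem_univ _)
    (Finset.mem_univ _) h1s]
  · -- the two surviving terms
    have hfix1 : ∀ i ∈ (Finset.univ.erase b).erase d, (1 : Equiv.Perm (Fin n)) i = i :=
      fun i _ => rfl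
    have hfixs : ∀ i ∈ (Finset.univ.erase b).erase d, Equiv.swap b d i = i := by
      intro i hi
      obtain ⟨hid, hi'⟩ := Finset.mem_erase.mp hi
      obtain ⟨hib, -⟩ := Finset.mem_erase.mp hi'
      exact Equiv.swap_apply_of_ne_of_ne hib hid
    rw [if_pos hfix1, if_pos hfixs]
    simp only [Equiv.Perm.one_apply, Equiv.swap_apply_left, Equiv.swap_apply_right,
      Equiv.Perm.sign_one, Equiv.Perm.sign_swap (Ne.symm hdb), Units.val_one, Units.val_neg,
      Int.cast_one, Int.cast_neg, mul_one, ne_eq, hdb, not_false_eq_true, true_and]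
    split_ifs <;> norm_num
  · intro π _ hπ
    split_ifs with hc hfix
    · exfalso
      rcases perm_eq_one_or_swap π hfix with h | h
      · exact hπ.1 h
      · exact hπ.2 h
    · exact mul_zero _
    · rfl

/-- **`Hess(det_n)(Id)` is nonsingular** (`n ≥ 2`): `Hess(det_n)(Id)·v = 0` forces `v_{dc} = 0` off the
diagonal and `∑_{b ≠ c} v_{bb} = 0` for all `c`, whence `(n−1)·∑_b v_{bb} = 0` and `v = 0`
(`hessianMatrix_detPoly_one_apply`; elementary, proof ours). [cite: MignonRessayre2004, §3.2.1 and Prop. 3.2 (preprint pp. 7, 10)] -/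
theorem isUnit_hessianMatrix_detPoly_one (h2 : 2 ≤ n) :
    IsUnit (hessianMatrix (detPoly (Fin n) ℂ) (fun p => (1 : Matrix (Fin n) (Fin n) ℂ) p.1 p.2)) := by
  classical
  set H := hessianMatrix (detPoly (Fin n) ℂ) (fun p => (1 : Matrix (Fin n) (Fin n) ℂ) p.1 p.2)
    with hH
  have hHe : ∀ a b c d : Fin n, H (c, d) (a, b) =
      if d = b then 0 else ((if b = a ∧ d = c then 1 else 0) - (if d = a ∧ b = c then 1 else 0)) :=
    fun a b c d => hessianMatrix_detPoly_one_apply a b c d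
  rw [← Matrix.mulVec_injective_iff_isUnit]
  suffices key : ∀ v, H *ᵥ v = 0 → v = 0 by
    intro v w hvw
    exact sub_eq_zero.mp (key (v - w) (by rw [Matrix.mulVec_sub, hvw, sub_self]))
  intro v hv
  -- off-diagonal coordinates vanish
  have hoff : ∀ c d : Fin n, c ≠ d → v (d, c) = 0 := by
    intro c d hcd
    have hdc : ¬ d = c := fun h' => hcd h'.symm
    have h := congr_fun hv (c, d)
    rw [Pi.zero_apply, Matrix.mulVec, dotProduct, Finset.sum_eq_single (d, c)] at h
    · rw [hHe, if_neg hdc] at h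
      have h1 : ¬ (c = d ∧ d = c) := fun h' => hcd h'.1
      rw [if_neg h1, if_pos ⟨rfl, rfl⟩, zero_sub, neg_one_mul, neg_eq_zero] at h
      exact h
    · rintro ⟨a, b⟩ - hq
      rw [hHe]
      by_cases hdb : d = b
      · rw [if_pos hdb, zero_mul]
      · have h1 : ¬ (b = a ∧ d = c) := fun h' => hdc h'.2
        have h2' : ¬ (d = a ∧ b = c) := by
          rintro ⟨rfl, rfl⟩
          exact hq rfl
        rw [if_neg hdb, if_neg h1, if_neg h2', sub_zero, zero_mul]
    · intro h'; exact absurd (Finset.mem_univ _) h'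
  -- diagonal coordinates: `∑_{a ≠ c} v (a,a) = 0` for every `c`
  have hdiag : ∀ c : Fin n, ∑ a, (if c = a then 0 else v (a, a)) = 0 := by
    intro c
    have h := congr_fun hv (c, c)
    rw [Pi.zero_apply, Matrix.mulVec, dotProduct, Fintype.sum_prod_type] at h
    have h' : ∑ a, (if c = a then 0 else v (a, a)) = ∑ x, ∑ y, H (c, c) (x, y) * v (x, y) := by
      refine Finset.sum_congr rfl fun a _ => ?_
      rw [Finset.sum_eq_single a]
      · rw [hHe]
        by_cases hca : c = a
        · subst hca
          rw [if_pos rfl, if_pos rfl, zero_mul]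
        · have h1 : ¬ (c = a ∧ a = c) := fun h' => hca h'.1
          rw [if_neg hca, if_neg hca, if_pos ⟨rfl, rfl⟩, if_neg h1, sub_zero, one_mul]
      · intro b _ hba
        rw [hoff b a hba, mul_zero]
      · intro h'; exact absurd (Finset.mem_univ _) h'
    rw [h', h]
  -- all diagonal coordinates equal their sum `S`, hence `(n - 1) S = 0`
  set S := ∑ a, v (a, a) with hS
  have hcc : ∀ c : Fin n, v (c, c) = S := by
    intro c
    have h1 := hdiag c
    have h2' : ∑ a, (if c = a then v (a, a) else 0) = v (c, c) := by
      rw [Finset.sum_ite_eq]; simp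
    calc v (c, c) = ∑ a, (if c = a then v (a, a) else 0) + ∑ a, (if c = a then 0 else v (a, a)) := by
          rw [h2', h1, add_zero]
      _ = S := by
          rw [hS, ← Finset.sum_add_distrib]
          exact Finset.sum_congr rfl fun a _ => by split_ifs <;> simp
  have hS0 : S = 0 := by
    have h3 : S = ∑ _a : Fin n, S := by
      conv_lhs => rw [hS]
      exact Finset.sum_congr rfl fun a _ => hcc a
    rw [Finset.sum_const, Finset.card_univ, Fintype.card_fin, nsmul_eq_mul] at h3
    have h4 : ((n : ℂ) - 1) * S = 0 := by linear_combination -h3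
    rcases mul_eq_zero.mp h4 with h5 | h5
    · exact absurd (sub_eq_zero.mp h5) (Nat.cast_ne_one.mpr (by omega))
    · exact h5
  funext q
  obtain ⟨i, j⟩ := q
  rw [Pi.zero_apply]
  by_cases hij : i = j
  · subst hij; rw [hcc, hS0]
  · exact hoff j i (Ne.symm hij)

end DetHessian

section Boundary

variable {n : ℕ}

/-- **`det_n ∉ Δ(P_Λ) = \overline{GL(W)·P_Λ}`** (`n` odd, `n ≥ 3`): `det Hess(·)(Id)` vanishes on `Δ(P_Λ)`
but not at `det_n`. Part of LMR 2013 Prop. 3.5.1 (b) ("… of the boundary of `\overline{GL(W)·[det_n]}`",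
p. 481); proof ours (Hessian invariant in place of the stabiliser count), disclosed in the module
docstring. [cite: LandsbergManivelRessayre2013, Proposition 3.5.1 (p. 481)] -/
theorem detPoly_not_mem_orbitClosure_pLambda (hn : Odd n) (h3 : 3 ≤ n) :
    detPoly (Fin n) ℂ ∉ orbitClosure (pLambda n) := fun hmem =>
  ((Matrix.isUnit_iff_isUnit_det _).mp (isUnit_hessianMatrix_detPoly_one (n := n) (by omega))).ne_zero
    (det_hessianMatrix_eq_zero_of_mem_orbitClosure_pLambda hn hmem _)

/-- **`Δ(P_Λ) ∩ GL(W)·det_n = ∅`** (`n` odd, `n ≥ 3`): orbit closures are `GL(W)`-stable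
(`orbitClosure_subset_of_mem_holds`), so a point of the orbit in `Δ(P_Λ)` would put `det_n` there.
[cite: LandsbergManivelRessayre2013, Proposition 3.5.1 (p. 481)] -/
theorem disjoint_orbitClosure_pLambda_glOrbit_detPoly (hn : Odd n) (h3 : 3 ≤ n) :
    Disjoint (orbitClosure (pLambda n)) (glOrbit (Fin n × Fin n) ℂ (detPoly (Fin n) ℂ)) := by
  rw [Set.disjoint_iff]
  rintro q ⟨hqP, hqD⟩
  apply detPoly_not_mem_orbitClosure_pLambda hn h3
  have h1 : detPoly (Fin n) ℂ ∈ glOrbit (Fin n × Fin n) ℂ q := by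
    rw [glOrbit_eq_of_mem hqD]; exact mem_glOrbit_self _
  exact orbitClosure_subset_of_mem_holds hqP (glOrbit_subset_orbitClosure _ h1)

/-- **LMR 2013, Prop. 3.5.1 (b), the inclusion: `\overline{GL(W)·P_Λ}` lies in the BOUNDARY
`\overline{GL(W)·det_n} ∖ GL(W)·det_n`** (`n` odd, `n ≥ 3`; with
`orbitClosure_pLambda_subset_orbitClosure_detPoly` of `LMR13BoundaryFormNotCone.lean`). The component /
codimension-one clauses of (b) stay in the named fact `LMR2013_prop_3_5_1`.
[cite: LandsbergManivelRessayre2013, Proposition 3.5.1 (p. 481)] -/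
theorem orbitClosure_pLambda_subset_boundary (hn : Odd n) (h3 : 3 ≤ n) :
    orbitClosure (pLambda n) ⊆
      orbitClosure (detPoly (Fin n) ℂ) \ glOrbit (Fin n × Fin n) ℂ (detPoly (Fin n) ℂ) :=
  fun _ hq => ⟨orbitClosure_pLambda_subset_orbitClosure_detPoly hn hq,
    fun hqD => Set.disjoint_left.mp (disjoint_orbitClosure_pLambda_glOrbit_detPoly hn h3) hq hqD⟩

end Boundary

section WhatRemains

/-- **LMR 2013, Prop. 3.5.1 — what remains after this file.** The named fact `LMR2013_prop_3_5_1` is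
EQUIVALENT to: for every odd `n ≥ 3`, `Δ(P_Λ)` is maximal among the irreducible subsets of the boundary
`Δ(det_n) ∖ GL(W)·det_n`, and `dim Δ(P_Λ) + 1 = dim Δ(det_n)` (cones in degree-`n` coefficient space) —
the printed "irreducible … component" maximality and "codimension one"; everything else of the
proposition ((a), `Δ(P_Λ) ⊆` boundary, irreducibility, (d) `⊄ End(W)·det_n`, `\overline{dc} = n < dc`)
is PROVED in the companions (`LMR2013_prop_3_5_1_iff` of `LMR13ResidualClauses.lean` +
`disjoint_orbitClosure_pLambda_glOrbit_detPoly`). [cite: LandsbergManivelRessayre2013, Proposition 3.5.1 (p. 481)] -/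
theorem LMR2013_prop_3_5_1_iff_maximal_codim :
    LMR2013_prop_3_5_1 ↔ ∀ n : ℕ, Odd n → 3 ≤ n →
      (∀ S' : Set (MvPolynomial (Fin n × Fin n) ℂ), IsCoeffZariskiIrreducible S' →
        orbitClosure (pLambda n) ⊆ S' →
          S' ⊆ orbitClosure (detPoly (Fin n) ℂ) \ glOrbit (Fin n × Fin n) ℂ (detPoly (Fin n) ℂ) →
            S' ⊆ orbitClosure (pLambda n)) ∧
      affineDimension (formCoeff n '' orbitClosure (pLambda n)) + 1 =
        affineDimension (formCoeff n '' orbitClosure (detPoly (Fin n) ℂ)) := by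
  rw [LMR2013_prop_3_5_1_iff]
  refine forall₃_congr fun n hn h3 => ?_
  rw [and_iff_right (disjoint_orbitClosure_pLambda_glOrbit_detPoly hn h3)]

end WhatRemains

end Literature.Computability.AlgebraicComplexity
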